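import Mathlib
import HarnessLib
import Literature.Combinatorics.Additive.StepBeyondKempermanClaimFive
import Literature.Combinatorics.Additive.StepBeyondKempermanClaimsNineTen

/-!
# Grynkiewicz 2009, Theorem 4.1 (first part) for finite `G` and `min(|A|, |B|) ≤ 3` — unconditionally

[cite: Grynkiewicz2009, Thm 4.1; §6 Claims 1–9 (pp. 23–29)] [tag: critical-pair] [tag: inverse-theorem]

Topic `Literature/Combinatorics/Additive`.  Cell `mm-stpp` (D-0046), seat `mm-stpp-lit` (gen 24); the
port of D. J. Grynkiewicz, *A step beyond Kemperman's structure theorem*, Mathematika **55** (2009)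
67–114 continued.  This file is STAGE 1 of the re-cut induction announced in
`StepBeyondKempermanClaimFive.lean` (there Theorem 4.1 is reduced to the hypothesis `deep`, quantified
over ALL pairs, whereas the printed deep core is itself an induction using the theorem for other pairs):

**`Grynkiewicz2009.conclusion_of_min_card_le_three`.**  Let `G` be a finite abelian group and `A, B ⊆ G`
nonempty with `|A + B| = |A| + |B|`, `A + B` aperiodic and `min(|A|, |B|) ≤ 3`.  Then (17) holds for some
`α, β`, or there are `H`, `A₁, A₀, B₁, B₀` with (i)–(iii) of Theorem 4.1 (`IsGrynkiewiczDecomp`).  No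
hypothesis beyond the printed ones.

PROOF (the print's, pp. 23–29, organised as a strong induction on `|A| + |B|` over all finite abelian
groups in the universe).  The reductions of Claims 1–4 (`conclusion_of_forall_not_isQuasiPeriodic`,
`conclusion_of_core₀`, `conclusion_of_core` of `StepBeyondKempermanReduction/Core.lean`) are re-run for an
arbitrary class `𝒞` of size pairs closed under decreasing either size and under swapping
(`conclusion_of_forall_not_isQuasiPeriodic_of_class`, `conclusion_of_core₀_of_class`,
`conclusion_of_core_of_class`; the proofs are those of the unrestricted versions with `𝒞` threaded — the
bottom pair of a quasi-periodic reduction has smaller sizes, translation and passage to `⟨A⟩` keep them);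
for a core pair with `|A| = 3` (`core_step_of_card_eq_three`): Claim 5 (`claim5_conclusion`:
`seventeen_or_fourPairs` + `fourPairs_conclusion`), Claim 6 (`conclusion_of_card_eq_three`), (47)
(`two_le_subsetDist_isQuasiPeriodic_or_seventeen`), (48) (`three_le_card_sdiff_compl_or_seventeen`), the
case `|A| = |\overline{A+B}| = 3` (`conclusion_of_card_eq_three_of_card_compl_eq_three`), (50)
(`seventeen_of_subsetDist_quasiProgression_le_one`), Claim 8 (`card_layerWith_le_one_and_or_seventeen`),
(45) (`not_isQuasiPeriodic_add_and_compl`), and finally CLAIM 9 (`claim9`), whose induction hypothesis —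
the theorem for the pairs `(A, B ∖ b)`, of smaller `|A| + |B|` and still with `min ≤ 3` — is the outer
induction hypothesis instantiated in the subgroup `⟨A⟩`.

WHAT THIS FILE IS NOT: nothing for `min(|A|, |B|) ≥ 4` (Claim 10 is kernel, `claim10`; Subcases 1, 2, 4
and the second stage of the induction remain); no infinite `G`; no new definitions, no named facts.

## References
* D. J. Grynkiewicz, *A step beyond Kemperman's structure theorem*, Mathematika 55 (2009) 67–114,
  doi:10.1112/S0025579300000966; Thm 4.1 (p. 10), §6 pp. 23–29 (held
  `paper:doi-10-1112-s0025579300000966`) [cite: Grynkiewicz2009, Thm 4.1].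
-/

namespace Literature.Combinatorics.Additive

open Finset
open scoped Pointwise

universe u

variable {G : Type u} [AddCommGroup G] [DecidableEq G]

namespace Grynkiewicz2009

/-- `¬ 2 ≤ x ⟹ x ≤ 1` in `ℕ∞`. [folklore] -/
private theorem le_one_of_not_two_le₃ {x : ℕ∞} (h : ¬ 2 ≤ x) : x ≤ 1 := by
  induction x using ENat.recTopCoe with
  | top => exact absurd le_top h
  | coe n =>
    have h' : ¬ (2 : ℕ) ≤ n := fun hn => h (by exact_mod_cast hn)
    exact_mod_cast (by omega : n ≤ 1)

/-! ### Claims 1–4 restricted to a class of sizes -/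

/-- `conclusion_of_forall_not_isQuasiPeriodic` (Claim 1, Lemma 5.3 and the lift) for pairs whose sizes
lie in a class `𝒞` closed under decreasing either size and under swapping: the core hypothesis is only
needed inside `𝒞`. [cite: Grynkiewicz2009, §6 Claim 1 (p. 23), Lemma 5.3] -/
theorem conclusion_of_forall_not_isQuasiPeriodic_of_class (𝒞 : ℕ → ℕ → Prop)
    (h𝒞 : ∀ {m n m' n' : ℕ}, m' ≤ m → n' ≤ n → 𝒞 m n → 𝒞 m' n') (h𝒞s : ∀ {m n : ℕ}, 𝒞 m n → 𝒞 n m)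
    (core : ∀ A B : Finset G, 𝒞 #A #B → A.Nonempty → B.Nonempty → #(A + B) = #A + #B →
      (A + B).addStab = {0} → IsNonExtendible A B → IsNonExtendible B A →
      ¬ IsQuasiPeriodic A → ¬ IsQuasiPeriodic B →
      ((∃ α β : G, #(insert α A + insert β B) + 1 = #(insert α A) + #(insert β B)) ∨
        ∃ (K : AddSubgroup G) (A₁ A₀ B₁ B₀ : Finset G), IsGrynkiewiczDecomp K A B A₁ A₀ B₁ B₀))
    {A B : Finset G} (hAB𝒞 : 𝒞 #A #B) (hA : A.Nonempty) (hB : B.Nonempty)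
    (hAB : #(A + B) = #A + #B) (haper : (A + B).addStab = {0}) :
    (∃ α β : G, #(insert α A + insert β B) + 1 = #(insert α A) + #(insert β B)) ∨
      ∃ (K : AddSubgroup G) (A₁ A₀ B₁ B₀ : Finset G), IsGrynkiewiczDecomp K A B A₁ A₀ B₁ B₀ := by
  suffices key : ∀ n : ℕ, ∀ A B : Finset G, #A + #B = n → 𝒞 #A #B → A.Nonempty → B.Nonempty →
      #(A + B) = #A + #B → (A + B).addStab = {0} →
      ((∃ α β : G, #(insert α A + insert β B) + 1 = #(insert α A) + #(insert β B)) ∨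
        ∃ (K : AddSubgroup G) (A₁ A₀ B₁ B₀ : Finset G), IsGrynkiewiczDecomp K A B A₁ A₀ B₁ B₀) from
    key _ A B rfl hAB𝒞 hA hB hAB haper
  intro n
  refine Nat.strong_induction_on n ?_
  intro n ih
  have step : ∀ A B : Finset G, #A + #B = n → 𝒞 #A #B → A.Nonempty → B.Nonempty →
      #(A + B) = #A + #B → (A + B).addStab = {0} → IsNonExtendible A B → IsNonExtendible B A →
      IsQuasiPeriodic A →
      ((∃ α β : G, #(insert α A + insert β B) + 1 = #(insert α A) + #(insert β B)) ∨
        ∃ (K : AddSubgroup G) (A₁ A₀ B₁ B₀ : Finset G), IsGrynkiewiczDecomp K A B A₁ A₀ B₁ B₀) := by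
    intro A B hn h𝒞AB hA hB hAB haper hneA hneB hAqp
    obtain ⟨H, Hf, A₁, A', B₁, B', hHf, hdA, hdB, hA₁, hA', hB', hiii, hi, hii⟩ :=
      exists_coarse_of_isQuasiPeriodic hAqp hB hAB haper hneA hneB
    have hlt : #A' + #B' < n := by
      rw [← hn, hdA.card_eq, hdB.card_eq]; have := hA₁.card_pos; omega
    have h𝒞' : 𝒞 #A' #B' :=
      h𝒞 (by rw [hdA.card_eq]; omega) (by rw [hdB.card_eq]; omega) h𝒞AB
    have haper' : (A' + B').addStab = {0} := by
      have hnp : ¬ IsPeriodic (A + B) := fun h => (isPeriodic_iff_addStab_ne (hA.add hB)).1 h haper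
      have := not_isPeriodic_bottom_of_coarse hdA hdB hA' hB' hnp
      by_contra hne
      exact this ((isPeriodic_iff_addStab_ne (hA'.add hB')).2 hne)
    have hbot := ih _ hlt A' B' rfl h𝒞' hA' hB' hiii haper'
    exact conclusion_of_coarse hHf hdA hdB hA' hB' hi hii hAB hiii hbot
  intro A B hn h𝒞AB hA hB hAB haper
  by_cases hneA : IsNonExtendible A B
  swap
  · unfold IsNonExtendible at hneA
    push Not at hneA
    obtain ⟨a, ha, heq⟩ := hneA
    exact Or.inl (seventeen_of_insert_add_eq ha heq hB hAB)
  by_cases hneB : IsNonExtendible B A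
  swap
  · unfold IsNonExtendible at hneB
    push Not at hneB
    obtain ⟨b, hb, heq⟩ := hneB
    rw [add_comm, add_comm B] at heq
    exact Or.inl (seventeen_of_add_insert_eq hb heq hA hAB)
  by_cases hAqp : IsQuasiPeriodic A
  · exact step A B hn h𝒞AB hA hB hAB haper hneA hneB hAqp
  by_cases hBqp : IsQuasiPeriodic B
  · have hBA : #(B + A) = #B + #A := by rw [add_comm, hAB, add_comm]
    have haper' : (B + A).addStab = {0} := by rwa [add_comm]
    exact conclusion_symm (step B A (by omega) (h𝒞s h𝒞AB) hB hA hBA haper' hneB hneA hBqp)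
  exact core A B h𝒞AB hA hB hAB haper hneA hneB hAqp hBqp

omit [DecidableEq G] in
/-- `(g + A) + (g' + B) = (g + g') + (A + B)`. [folklore] -/
private theorem vadd_add_vadd_eq₁₀ [DecidableEq G] (A B : Finset G) (g g' : G) :
    (g +ᵥ A) + (g' +ᵥ B) = (g + g') +ᵥ (A + B) := by
  rw [add_vadd_comm, vadd_add_assoc, vadd_vadd, add_comm g' g]

/-- `conclusion_of_core₀` (Claims 2, 3 and «w.l.o.g. `0 ∈ A ∩ B`») for a class `𝒞` of sizes as above.
[cite: Grynkiewicz2009, §6 Claims 2–3 (pp. 23–24)] -/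
theorem conclusion_of_core₀_of_class (𝒞 : ℕ → ℕ → Prop)
    (h𝒞 : ∀ {m n m' n' : ℕ}, m' ≤ m → n' ≤ n → 𝒞 m n → 𝒞 m' n') (h𝒞s : ∀ {m n : ℕ}, 𝒞 m n → 𝒞 n m)
    (core₀ : ∀ A B : Finset G, 𝒞 #A #B → (0 : G) ∈ A → (0 : G) ∈ B → 3 ≤ #A → 3 ≤ #B →
      #(A + B) = #A + #B → (A + B).addStab = {0} →
      (∀ P : Finset G, A + B ⊆ P → P.addStab ≠ {0} → 2 ≤ #(P \ (A + B))) →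
      IsNonExtendible A B → IsNonExtendible B A → ¬ IsQuasiPeriodic A → ¬ IsQuasiPeriodic B →
      ((∃ α β : G, #(insert α A + insert β B) + 1 = #(insert α A) + #(insert β B)) ∨
        ∃ (K : AddSubgroup G) (A₁ A₀ B₁ B₀ : Finset G), IsGrynkiewiczDecomp K A B A₁ A₀ B₁ B₀))
    {A B : Finset G} (hAB𝒞 : 𝒞 #A #B) (hA : A.Nonempty) (hB : B.Nonempty)
    (hAB : #(A + B) = #A + #B) (haper : (A + B).addStab = {0}) :
    (∃ α β : G, #(insert α A + insert β B) + 1 = #(insert α A) + #(insert β B)) ∨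
      ∃ (K : AddSubgroup G) (A₁ A₀ B₁ B₀ : Finset G), IsGrynkiewiczDecomp K A B A₁ A₀ B₁ B₀ := by
  refine conclusion_of_forall_not_isQuasiPeriodic_of_class 𝒞 h𝒞 h𝒞s ?_ hAB𝒞 hA hB hAB haper
  intro A B h𝒞AB hA hB hAB haper hneA hneB hAqp hBqp
  -- Claim 2: `d⊆(A + B, 𝒫) ≥ 2`, else (17)
  by_cases hP2 : ∀ P : Finset G, A + B ⊆ P → P.addStab ≠ {0} → 2 ≤ #(P \ (A + B))
  swap
  · push Not at hP2
    obtain ⟨P, hsub, hper, hlt⟩ := hP2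
    rcases Nat.lt_or_ge 0 #(P \ (A + B)) with hpos | hzero
    · have h1 : #(P \ (A + B)) = 1 := by omega
      obtain ⟨γ, hγ⟩ := card_eq_one.1 h1
      have hγmem : γ ∈ P \ (A + B) := by rw [hγ]; exact mem_singleton_self _
      rw [mem_sdiff] at hγmem
      have hP : P = insert γ (A + B) := by
        rw [insert_eq, ← hγ, sdiff_union_of_subset hsub]
      refine Or.inl (seventeen_of_addStab_insert_ne hγmem.2 hAB ?_)
      rw [← hP]; exact hper
    · have h0 : P \ (A + B) = ∅ := card_eq_zero.1 (by omega)
      have hP : P = A + B := Subset.antisymm (sdiff_eq_empty_iff_subset.1 h0) hsub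
      rw [hP] at hper
      exact absurd haper hper
  -- Claim 3: `|A|, |B| ≥ 3`
  have hBA : #(B + A) = #B + #A := by rw [add_comm, hAB, add_comm]
  have h2A : 2 ≤ #A := two_le_card_right hA hBA
  have h2B : 2 ≤ #B := two_le_card_right hB hAB
  have hG : (⊤ : AddSubgroup G) ≠ ⊥ := by
    intro h
    have hx : ∀ x : G, x = 0 := fun x => by
      have hx : x ∈ (⊤ : AddSubgroup G) := AddSubgroup.mem_top x
      rw [h] at hx
      exact AddSubgroup.mem_bot.1 hx
    have hsub : A ⊆ {0} := fun x _ => mem_singleton.2 (hx x)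
    have := card_le_card hsub
    rw [card_singleton] at this
    omega
  by_cases hA2 : #A = 2
  · exact Or.inr ⟨⊤, ∅, A, ∅, B, isGrynkiewiczDecomp_top_of_card_eq_two hG hA2 hAB⟩
  by_cases hB2 : #B = 2
  · exact Or.inr ⟨⊤, ∅, A, ∅, B, isGrynkiewiczDecomp_top_of_card_eq_two' hG hB2 hAB⟩
  have hA3 : 3 ≤ #A := by omega
  have hB3 : 3 ≤ #B := by omega
  -- «We may assume w.l.o.g. that `0 ∈ A ∩ B`»
  obtain ⟨a, ha⟩ := hA
  obtain ⟨b, hb⟩ := hB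
  have hsum : ((-a) +ᵥ A) + ((-b) +ᵥ B) = (-a + -b) +ᵥ (A + B) := vadd_add_vadd_eq₁₀ A B _ _
  have h0A : (0 : G) ∈ (-a) +ᵥ A := mem_vadd_finset.2 ⟨a, ha, by simp⟩
  have h0B : (0 : G) ∈ (-b) +ᵥ B := mem_vadd_finset.2 ⟨b, hb, by simp⟩
  have hAB' : #(((-a) +ᵥ A) + ((-b) +ᵥ B)) = #((-a) +ᵥ A) + #((-b) +ᵥ B) := by
    rw [hsum, card_vadd_finset, card_vadd_finset, card_vadd_finset, hAB]
  have haper' : (((-a) +ᵥ A) + ((-b) +ᵥ B)).addStab = {0} := by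
    rw [hsum, addStab_vadd]; exact haper
  have hP2' : ∀ P : Finset G, ((-a) +ᵥ A) + ((-b) +ᵥ B) ⊆ P → P.addStab ≠ {0} →
      2 ≤ #(P \ (((-a) +ᵥ A) + ((-b) +ᵥ B))) := by
    rw [hsum]; exact forall_card_sdiff_vadd _ hP2
  have h := core₀ ((-a) +ᵥ A) ((-b) +ᵥ B) (by rw [card_vadd_finset, card_vadd_finset]; exact h𝒞AB)
    h0A h0B (by rw [card_vadd_finset]; exact hA3)
    (by rw [card_vadd_finset]; exact hB3) hAB' haper' hP2'
    ((hneA.vadd_left (-a)).vadd_right (-b)) ((hneB.vadd_left (-b)).vadd_right (-a))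
    (fun h => hAqp ((isQuasiPeriodic_vadd_iff _).1 h)) (fun h => hBqp ((isQuasiPeriodic_vadd_iff _).1 h))
  rcases h with h17 | hdec
  · exact Or.inl (seventeen_of_vadd h17)
  · exact Or.inr (exists_isGrynkiewiczDecomp_of_vadd hdec)

/-- `conclusion_of_core` (Claim 4: pass to `G′ = ⟨A⟩ = ⟨B⟩`) for a class `𝒞` of sizes as above.
[cite: Grynkiewicz2009, §6 Claim 4 (p. 24)] -/
theorem conclusion_of_core_of_class (𝒞 : ℕ → ℕ → Prop)
    (h𝒞 : ∀ {m n m' n' : ℕ}, m' ≤ m → n' ≤ n → 𝒞 m n → 𝒞 m' n') (h𝒞s : ∀ {m n : ℕ}, 𝒞 m n → 𝒞 n m)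
    (core : ∀ (G' : AddSubgroup G) (A B : Finset ↥G'), 𝒞 #A #B → (0 : ↥G') ∈ A → (0 : ↥G') ∈ B →
      3 ≤ #A → 3 ≤ #B → #(A + B) = #A + #B → (A + B).addStab = {0} →
      (∀ P : Finset ↥G', A + B ⊆ P → P.addStab ≠ {0} → 2 ≤ #(P \ (A + B))) →
      IsNonExtendible A B → IsNonExtendible B A → ¬ IsQuasiPeriodic A → ¬ IsQuasiPeriodic B →
      AddSubgroup.closure (A : Set ↥G') = ⊤ → AddSubgroup.closure (B : Set ↥G') = ⊤ →
      ((∃ α β : ↥G', #(insert α A + insert β B) + 1 = #(insert α A) + #(insert β B)) ∨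
        ∃ (K : AddSubgroup ↥G') (A₁ A₀ B₁ B₀ : Finset ↥G'), IsGrynkiewiczDecomp K A B A₁ A₀ B₁ B₀))
    {A B : Finset G} (hAB𝒞 : 𝒞 #A #B) (hA : A.Nonempty) (hB : B.Nonempty)
    (hAB : #(A + B) = #A + #B) (haper : (A + B).addStab = {0}) :
    (∃ α β : G, #(insert α A + insert β B) + 1 = #(insert α A) + #(insert β B)) ∨
      ∃ (K : AddSubgroup G) (A₁ A₀ B₁ B₀ : Finset G), IsGrynkiewiczDecomp K A B A₁ A₀ B₁ B₀ := by
  classical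
  refine conclusion_of_core₀_of_class 𝒞 h𝒞 h𝒞s ?_ hAB𝒞 hA hB hAB haper
  intro A B h𝒞AB h0A h0B hA3 hB3 hAB haper hP2 hneA hneB hAqp hBqp
  -- Lemma 5.2: `⟨A⟩ = ⟨B⟩`
  have hcl : AddSubgroup.closure (A : Set G) = AddSubgroup.closure (B : Set G) :=
    closure_eq_closure_of_not_isQuasiPeriodic hA3 hB3 h0A h0B hAB haper hneA hneB hAqp hBqp
  have hAG : (A : Set G) ⊆ AddSubgroup.closure (A : Set G) := AddSubgroup.subset_closure
  have hBG : (B : Set G) ⊆ AddSubgroup.closure (A : Set G) := by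
    rw [hcl]; exact AddSubgroup.subset_closure
  have hAne : A.Nonempty := ⟨0, h0A⟩
  have hBne : B.Nonempty := ⟨0, h0B⟩
  have hABG := coe_add_subset hAG hBG
  have h0A' : (0 : ↥(AddSubgroup.closure (A : Set G))) ∈ toSub _ A := mem_toSub.2 h0A
  have h0B' : (0 : ↥(AddSubgroup.closure (A : Set G))) ∈ toSub _ B := mem_toSub.2 h0B
  have h := core (AddSubgroup.closure (A : Set G)) (toSub _ A) (toSub _ B)
    (by rw [card_toSub hAG, card_toSub hBG]; exact h𝒞AB) h0A' h0B'
    (by rw [card_toSub hAG]; exact hA3) (by rw [card_toSub hBG]; exact hB3)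
    (by rw [← toSub_add hAG hBG, card_toSub hABG, card_toSub hAG, card_toSub hBG]; exact hAB)
    (by rw [← toSub_add hAG hBG]; exact addStab_toSub_eq_singleton hABG (hAne.add hBne) haper)
    (by rw [← toSub_add hAG hBG]; exact forall_card_sdiff_toSub hABG (hAne.add hBne) hP2)
    (isNonExtendible_toSub hAG hBG hneA) (isNonExtendible_toSub hBG hAG hneB)
    (fun h => hAqp (isQuasiPeriodic_of_toSub hAG h)) (fun h => hBqp (isQuasiPeriodic_of_toSub hBG h))
    (closure_toSub_eq_top rfl) (closure_toSub_eq_top hcl.symm)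
  exact conclusion_of_toSub hAG hBG h

/-! ### The core pipeline for `|A| = 3` -/

/-- **Claim 5 as a standalone implication (finite `G`).**  A core pair with `d⊆(A + B, 𝒫) ≤ 2`
satisfies the conclusion of Theorem 4.1 (`seventeen_or_fourPairs` + `fourPairs_conclusion`).
[cite: Grynkiewicz2009, §6 Claim 5 (pp. 24–26)] -/
theorem claim5_conclusion [Fintype G] {A B : Finset G} (h0A : (0 : G) ∈ A) (h0B : (0 : G) ∈ B)
    (hA3 : 3 ≤ #A) (hAB : #(A + B) = #A + #B) (haper : (A + B).addStab = {0})
    (hP2 : ∀ P : Finset G, A + B ⊆ P → P.addStab ≠ {0} → 2 ≤ #(P \ (A + B)))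
    (hneA : IsNonExtendible A B) (hneB : IsNonExtendible B A)
    (hAqp : ¬ IsQuasiPeriodic A) (hBqp : ¬ IsQuasiPeriodic B)
    (hgenA : AddSubgroup.closure (A : Set G) = ⊤) (hgenB : AddSubgroup.closure (B : Set G) = ⊤)
    (hP : ∃ P : Finset G, A + B ⊆ P ∧ P.addStab ≠ {0} ∧ #(P \ (A + B)) ≤ 2) :
    (∃ α β : G, #(insert α A + insert β B) + 1 = #(insert α A) + #(insert β B)) ∨
      ∃ (K : AddSubgroup G) (A₁ A₀ B₁ B₀ : Finset G), IsGrynkiewiczDecomp K A B A₁ A₀ B₁ B₀ := by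
  classical
  obtain ⟨P, hPsub, hPper, hPle⟩ := hP
  rcases seventeen_or_fourPairs h0A h0B hAB haper hP2 hneA hneB hAqp hBqp hgenA hgenB hPsub hPper hPle
    with h17 | ⟨H, Hf, γ₁, γ₂, x, y, x', y', hframe⟩
  · exact Or.inl h17
  · exact fourPairs_conclusion h0A h0B hA3 H Hf γ₁ γ₂ x y x' y' hframe

/-- **The core step for `|A| = 3`.**  For a core pair (`0 ∈ A ∩ B`, `|A| = 3 ≤ |B|`,
`|A + B| = |A| + |B|`, `A + B` aperiodic, `d⊆(A + B, 𝒫) ≥ 2`, non-extendible, not quasi-periodic,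
generating) in a finite `G`, the conclusion of Theorem 4.1 holds, GIVEN the theorem for all pairs
`A′, B′ ⊆ G` with `|A′| + |B′| < |A| + |B|` and `min(|A′|, |B′|) ≤ 3` (used through Claim 9 for the
pairs `(A, B ∖ b)`).  Claims 5, 6, (47), (48), the case `|A| = |\overline{A+B}| = 3`, (50), Claim 8,
(45), Claim 9. [cite: Grynkiewicz2009, §6 Claims 5–9 (pp. 24–29)] -/
theorem core_step_of_card_eq_three [Fintype G] {N : ℕ}
    (IH : ∀ A' B' : Finset G, #A' + #B' ≤ N → A'.Nonempty → B'.Nonempty →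
      #(A' + B') = #A' + #B' → (A' + B').addStab = {0} → min #A' #B' ≤ 3 →
      ((∃ α β : G, #(insert α A' + insert β B') + 1 = #(insert α A') + #(insert β B')) ∨
        ∃ (K : AddSubgroup G) (A₁ A₀ B₁ B₀ : Finset G), IsGrynkiewiczDecomp K A' B' A₁ A₀ B₁ B₀))
    {A B : Finset G} (hsum : #A + #B ≤ N + 1) (h0A : (0 : G) ∈ A) (h0B : (0 : G) ∈ B)
    (hA3 : #A = 3) (hB3 : 3 ≤ #B) (hAB : #(A + B) = #A + #B) (haper : (A + B).addStab = {0})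
    (hP2 : ∀ P : Finset G, A + B ⊆ P → P.addStab ≠ {0} → 2 ≤ #(P \ (A + B)))
    (hneA : IsNonExtendible A B) (hneB : IsNonExtendible B A)
    (hAqp : ¬ IsQuasiPeriodic A) (hBqp : ¬ IsQuasiPeriodic B)
    (hgenA : AddSubgroup.closure (A : Set G) = ⊤) (hgenB : AddSubgroup.closure (B : Set G) = ⊤) :
    (∃ α β : G, #(insert α A + insert β B) + 1 = #(insert α A) + #(insert β B)) ∨
      ∃ (K : AddSubgroup G) (A₁ A₀ B₁ B₀ : Finset G), IsGrynkiewiczDecomp K A B A₁ A₀ B₁ B₀ := by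
  have hA3' : 3 ≤ #A := by omega
  -- Claim 5
  by_cases hP3 : ∀ P : Finset G, A + B ⊆ P → P.addStab ≠ {0} → 3 ≤ #(P \ (A + B))
  swap
  · push Not at hP3
    obtain ⟨P, h1, h2, h3⟩ := hP3
    exact claim5_conclusion h0A h0B hA3' hAB haper hP2 hneA hneB hAqp hBqp hgenA hgenB
      ⟨P, h1, h2, by omega⟩
  -- Claim 6
  by_cases hB4 : 4 ≤ #B
  swap
  · exact conclusion_of_card_eq_three hA3 (by omega) hAB haper hAqp hBqp
  have hC3 : 3 ≤ #(A + B)ᶜ := three_le_card_compl_of_forall (by omega) hP3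
  -- (47)
  rcases two_le_subsetDist_isQuasiPeriodic_or_seventeen hA3' hB3 (Or.inr hB4) h0A h0B hAB hP3 hneA hneB
    hgenA hgenB hAqp hBqp with ⟨h47A, -⟩ | h17
  swap
  · exact Or.inl h17
  -- «|A| = |\overline{A + B}| = 3 ⟹ type (VII)»
  by_cases h33 : #A = 3 ∧ #(A + B)ᶜ = 3
  · exact conclusion_of_card_eq_three_of_card_compl_eq_three h0A h0B h33.1 hB3 h33.2 hAB haper hneA
      hneB hgenA hAqp hBqp
  -- (50) for `A`
  by_cases h50A : ∀ d : G, d ≠ 0 → 2 ≤ subsetDist A {P | IsQuasiProgression d P}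
  swap
  · push Not at h50A
    obtain ⟨d, hd, hlt⟩ := h50A
    exact Or.inl (seventeen_of_subsetDist_quasiProgression_le_one hA3' hB3 h0A h0B hAB hP3 hneA hneB
      hgenA h47A hd (le_one_of_not_two_le₃ (not_le.2 hlt)) fun h3 hC => h33 ⟨h3, hC⟩)
  -- Claim 8
  rcases card_layerWith_le_one_and_or_seventeen h0A h0B hA3' hB3 hAB haper hneA hneB hgenA hgenB hAqp
    hBqp with ⟨hN1B, -⟩ | h17
  swap
  · exact Or.inl h17
  -- (45)
  have h45 := (not_isQuasiPeriodic_add_and_compl hA3' hC3 h0A h0B hAB haper hneA hneB hgenA hAqp).1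
  have hcompl : 4 ≤ #(A + B)ᶜ := by
    by_contra h
    exact h33 ⟨hA3, by omega⟩
  -- Claim 9: `|A| = 3` is impossible
  refine (claim9 h0A h0B hA3 hB4 hAB hcompl hgenA h47A h50A hN1B h45 fun b hb hcard hap => ?_).elim
  have hBb : #(B.erase b) = #B - 1 := card_erase_of_mem hb
  exact IH A (B.erase b) (by rw [hBb]; omega) ⟨0, h0A⟩ (card_pos.1 (by rw [hBb]; omega)) hcard hap
    (by rw [hA3]; omega)

/-! ### Stage 1 of the induction: `min(|A|, |B|) ≤ 3` -/

/-- **Theorem 4.1 (first part) for finite groups and `min(|A|, |B|) ≤ 3`, as a statement over all finite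
abelian groups of the universe, by strong induction on `|A| + |B|`.**
[cite: Grynkiewicz2009, Thm 4.1; §6 Claims 1–9 (pp. 23–29)] -/
theorem conclusion_of_min_card_le_three_aux (N : ℕ) :
    ∀ (K : Type u) [AddCommGroup K] [Fintype K] [DecidableEq K] (A B : Finset K),
      #A + #B ≤ N → A.Nonempty → B.Nonempty → #(A + B) = #A + #B → (A + B).addStab = {0} →
      min #A #B ≤ 3 →
      ((∃ α β : K, #(insert α A + insert β B) + 1 = #(insert α A) + #(insert β B)) ∨
        ∃ (L : AddSubgroup K) (A₁ A₀ B₁ B₀ : Finset K), IsGrynkiewiczDecomp L A B A₁ A₀ B₁ B₀) := by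
  induction N with
  | zero =>
    intro K _ _ _ A B hN hA
    have := hA.card_pos
    omega
  | succ N ih =>
    intro K _ _ _ A B hN hA hB hAB haper hmin
    refine conclusion_of_core_of_class (G := K) (fun m n => min m n ≤ 3 ∧ m + n ≤ N + 1) ?_ ?_ ?_
      ⟨hmin, hN⟩ hA hB hAB haper
    · intro m n m' n' hm hn h
      obtain ⟨h1, h2⟩ := h
      constructor <;> omega
    · intro m n h
      obtain ⟨h1, h2⟩ := h
      constructor <;> omega
    · intro G' A B h𝒞AB h0A h0B hA3 hB3 hAB haper hP2 hneA hneB hAqp hBqp hgenA hgenB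
      obtain ⟨hmin', hsum'⟩ := h𝒞AB
      haveI : Fintype ↥G' := Fintype.ofFinite _
      have IH' : ∀ A' B' : Finset ↥G', #A' + #B' ≤ N → A'.Nonempty → B'.Nonempty →
          #(A' + B') = #A' + #B' → (A' + B').addStab = {0} → min #A' #B' ≤ 3 →
          ((∃ α β : ↥G', #(insert α A' + insert β B') + 1 = #(insert α A') + #(insert β B')) ∨
            ∃ (L : AddSubgroup ↥G') (A₁ A₀ B₁ B₀ : Finset ↥G'),
              IsGrynkiewiczDecomp L A' B' A₁ A₀ B₁ B₀) :=
        fun A' B' h1 h2 h3 h4 h5 h6 => ih (↥G') A' B' h1 h2 h3 h4 h5 h6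
      rcases (by omega : #A = 3 ∨ #B = 3) with hA3' | hB3'
      · exact core_step_of_card_eq_three IH' hsum' h0A h0B hA3' hB3 hAB haper hP2 hneA hneB hAqp hBqp
          hgenA hgenB
      · have hBA : #(B + A) = #B + #A := by rw [add_comm, hAB, add_comm]
        have haper' : (B + A).addStab = {0} := by rwa [add_comm]
        have hP2' : ∀ P : Finset ↥G', B + A ⊆ P → P.addStab ≠ {0} → 2 ≤ #(P \ (B + A)) := by
          rw [add_comm]; exact hP2
        exact conclusion_symm (core_step_of_card_eq_three IH' (by omega) h0B h0A hB3' hA3 hBA haper'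
          hP2' hneB hneA hBqp hAqp hgenB hgenA)

/-- **Theorem 4.1 (first part), finite `G`, `min(|A|, |B|) ≤ 3` — unconditionally.**  Let `G` be a
finite abelian group and `A, B ⊆ G` nonempty with `|A + B| = |A| + |B|`, `A + B` aperiodic and
`min(|A|, |B|) ≤ 3`.  Then either (17) holds for some `α, β`, or there are a nontrivial subgroup `H` and
`A₁, A₀, B₁, B₀` with (i)–(iii) of Theorem 4.1 (`IsGrynkiewiczDecomp`).
[cite: Grynkiewicz2009, Thm 4.1; §6 Claims 1–9 (pp. 23–29)] -/
theorem conclusion_of_min_card_le_three [Fintype G] {A B : Finset G} (hA : A.Nonempty)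
    (hB : B.Nonempty) (hAB : #(A + B) = #A + #B) (haper : (A + B).addStab = {0})
    (hmin : min #A #B ≤ 3) :
    (∃ α β : G, #(insert α A + insert β B) + 1 = #(insert α A) + #(insert β B)) ∨
      ∃ (K : AddSubgroup G) (A₁ A₀ B₁ B₀ : Finset G), IsGrynkiewiczDecomp K A B A₁ A₀ B₁ B₀ :=
  conclusion_of_min_card_le_three_aux (#A + #B) G A B le_rfl hA hB hAB haper hmin

end Grynkiewicz2009

end Literature.Combinatorics.Additive
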